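import Summits.ResolutionOfSingularities.ResolutionOfSingularities.Theorems.EquisingularLiftEquisingularLiftNatTowerBAwayTransport
import Summits.ResolutionOfSingularities.ResolutionOfSingularities.Theorems.EquisingularLiftEquisingularLiftNatTowerInvBDefs
import Summits.ResolutionOfSingularities.ResolutionOfSingularities.Theorems.EquisingularLiftEquisingularLiftNatTowerRoundBDefs
import HarnessLib

/-!
# [OURS · L1 W4.5(b) · EL♮(3)] T23-A ENGINE — THE POINT STEPS ON `Tower.InvB`: `TowerPtRegB` / `TowerPtRamB` closure of the B-invariant
# (explicit-stage PATTERN file of the B engine; rung `stub_elnat_defTowerBPointResolutionThree`, TWENTY-SIXTH registration)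

res-L1-w45b-stub-4 g10 (T23-A ENGINE OWNER; word `L/res-L1-w45b-stub-4/T23A-ENGINE-WORD.md` 340f00d84dbcbbfc). Defs of record: res-L1-w45b-lead-2 g4
…NatTowerRoundBDefs (p601799: `PtTransportOK`, `TowerPtRegB`, `TowerPtRamB`, …) and …NatTowerInvBDefs (p602188: `Tower.StageB`, `Tower.InvB`). Crux EL♮(3) =
stmt-ResolutionOfSingularities-20148 (parent stmt-…-20038), route `EquisingularLift`, line `sections`. OURS; NOT a statement of any manuscript; AI-written,
weaker than expert review. DEF-FREE; no `sorry`; standard axioms; `--supports stmt-ResolutionOfSingularities-20148 --as helper`.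

WHAT. The (pt-reg) / (pt-ram) clauses of the B-driver at `INV₁ := Tower.InvB … Ruled …` for any ruled-surface datum `Ruled` that is ISO-INVARIANT
(`hRuledIso`; the engine's datum `FE` = «`V(𝓔)` is `O`-flat» is): `Tower.towerPtRegB_invB`, `Tower.towerPtRamB_invB`. PATTERN (the shape every B-step brick
follows): unpack the ONE upstairs stage of `Tower.InvB`; build the stage step EXPLICITLY (`modelPointStep` + `modelPointStep_of_section`, resp.
`fatPointStep_model` — verbatim the constructions inside `Tower.towerPtReg₂_inv₃` / `Tower.exists_ptRam_stage₃`, …NatTowerPtStepsInvThree); then, IN THAT SAME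
NEW STAGE `X'' = Bl X`, (i) the running surface by `Tower.noRound_pointCentre_new` / `Tower.exc₃_pointCentre_transport` (…NatTowerBAwayTransport), (ii) EVERY
retained member `F' ∈ Es'` — an admissible point-transport `PtTransportOK` of some `F ∈ E :: Es` — by the brick B-AWAY `Tower.exc₃_transport_away` (the
section / fat-point centre meets the special fibre in `jG pt` only, so it misses every model of a member not through `pt`), (iii) the bookkeeping
`¬ T' ⊆ F'` by `not_closure_preimage_diff_subset` (irreducibility of `T`). `Tower.invB_pointStep` is the centre-agnostic core shared by both clauses.
-/

set_option linter.dupNamespace false -- mandated namespace `Summit.<Summit>.<Problem>` of this single-conjunct summit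
set_option linter.overlappingInstances false -- the binders carry `[IsDomain O] [IsDiscreteValuationRing O]`

noncomputable section

open CategoryTheory CategoryTheory.Limits AlgebraicGeometry TopologicalSpace Topology IsLocalRing
open Literature.AlgebraicGeometry.Resolution
open AlgebraicGeometry.Scheme.IdealSheafData
open Summit.ResolutionOfSingularities.ResolutionOfSingularities.Theses.EquisingularLift.Split
open Summit.ResolutionOfSingularities.ResolutionOfSingularities.Cruxes.EquisingularLift.StrataSplit

namespace Summit.ResolutionOfSingularities.ResolutionOfSingularities.Cruxes.EquisingularLiftNat.Sections

/-! ## Bookkeeping: the transported strict transform is not inside a transported surface -/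

/-- **`¬ T' ⊆ F'` through a step.** `T` irreducible, `F` and `Zc` closed with `T ⊄ F`, `T ⊄ Zc`, and the downstairs blow-up `υ₂` centred inside `Zc`:
then `closure υ₂⁻¹(T ∖ Zc) ⊄ closure υ₂⁻¹(F ∖ Zc)` (a point of `T` off `F ∪ Zc` lifts). [folklore] -/
theorem not_closure_preimage_diff_subset {G G' : Scheme.{0}} [IsLocallyNoetherian G] {υ₂ : G' ⟶ G} {D : G.IdealSheafData}
    (hυ₂ : IsBlowup υ₂ D) {T F Zc : Set G} (hTirr : IsIrreducible T) (hF : IsClosed F) (hZc : IsClosed Zc) (hTF : ¬ T ⊆ F)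
    (hTZ : ¬ T ⊆ Zc) (hDZ : (D.support : Set G) ⊆ Zc) :
    ¬ closure (υ₂ ⁻¹' (T \ Zc)) ⊆ closure (υ₂ ⁻¹' (F \ Zc)) := by
  have hsub : closure (υ₂ ⁻¹' (F \ Zc)) ⊆ υ₂ ⁻¹' F := closure_minimal (fun z hz => hz.1) (hF.preimage υ₂.continuous)
  have hex : ∃ t ∈ T, t ∉ F ∧ t ∉ Zc := by
    by_contra hcon
    push Not at hcon
    have hTsub : T ⊆ F ∪ Zc := fun t ht => by
      by_cases h : t ∈ F
      · exact Or.inl h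
      · exact Or.inr (hcon t ht h)
    rcases (isPreirreducible_iff_isClosed_union_isClosed.mp hTirr.isPreirreducible) _ _ hF hZc hTsub with h | h
    · exact hTF h
    · exact hTZ h
  obtain ⟨t, htT, htF, htZ⟩ := hex
  have htD : t ∉ (D.support : Set G) := fun h => htZ (hDZ h)
  obtain ⟨t₂, ht₂⟩ := exists_preimage_of_not_mem_support υ₂ D hυ₂ htD
  intro hcontra
  have h1 : t₂ ∈ closure (υ₂ ⁻¹' (T \ Zc)) := subset_closure (by rw [Set.mem_preimage, ht₂]; exact ⟨htT, htZ⟩)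
  have h2 := hsub (hcontra h1)
  rw [Set.mem_preimage, ht₂] at h2
  exact htF h2

/-! ## The centre-agnostic core: a point step on `Tower.InvB` at an explicit stage step -/

section PointStepCore

variable (O : Type) [CommRing O] (k : Type) [Field k] (θ : O →+* k) (P : Scheme.{0}) (q : P ⟶ Spec (.of O)) (Y : Set P)
  (Ch : ∀ X' : Scheme.{0}, (X' ⟶ P) → Set X' → Prop) (Ruled : Tower.RuledDatum P)
  {F₉ : Scheme.{0}} {Z₉ : Set F₉} {hZ₉ : IsClosed Z₉} {F₁₀ : Scheme.{0}} {υ' : F₁₀ ⟶ F₉}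
  -- an ISO-INVARIANT ruled datum (the engine's `FE` = O-flatness of `V(𝓔)` is one)
  (hRuledIso : ∀ (G₀ G₀' : Scheme.{0}) (γ₀ : G₀ ⟶ F₁₀) (γ₀' : G₀' ⟶ F₁₀) (E₀ : Set G₀) (E₀' : Set G₀') (X₀ X₀'' : Scheme.{0})
      (σ₀ : X₀ ⟶ P) (j₀ : G₀ ⟶ X₀) (j₀' : G₀' ⟶ X₀'') (𝓔₀ : X₀.IdealSheafData) (τ₀ : X₀'' ⟶ X₀),
    (∃ e : (𝓔₀.comap τ₀).subscheme ≅ 𝓔₀.subscheme, e.hom ≫ 𝓔₀.subschemeι = (𝓔₀.comap τ₀).subschemeι ≫ τ₀) →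
    Ruled F₉ Z₉ hZ₉ F₁₀ υ' G₀ γ₀ E₀ X₀ σ₀ j₀ 𝓔₀ → Ruled F₉ Z₉ hZ₉ F₁₀ υ' G₀' γ₀' E₀' X₀'' (τ₀ ≫ σ₀) j₀' (𝓔₀.comap τ₀))
  {G G' X X'' : Scheme.{0}} {γ : G ⟶ F₁₀} {T E : Set G} {Es : List (Set G)} {K : Set G}
  -- the old invariant, unpacked
  (hυ' : IsBlowup υ' (vanishingIdeal (⟨Z₉, hZ₉⟩ : Closeds F₉))) (hZ₉inf : Z₉.Infinite)
  (hTirr : IsIrreducible T) (hEcl : IsClosed E) (hTE : ¬ T ⊆ E) (hEsB : ∀ F ∈ Es, IsClosed F ∧ ¬ T ⊆ F)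
  {σ : X ⟶ P} {jG : G ⟶ X}
  (hExc : ∀ hE : IsClosed E, Tower.Exc₃ O P q Y Ruled Z₉ hZ₉ υ' G γ E hE K X σ jG)
  (hExcF : ∀ F ∈ Es, ∀ hF : IsClosed F, Tower.Exc₃ O P q Y Ruled Z₉ hZ₉ υ' G γ F hF ∅ X σ jG)
  -- the point, the downstairs centre and its blow-up
  {pt : G} (hyc : IsClosed ({pt} : Set G)) (hTy : ¬ T ⊆ {pt}) {D : G.IdealSheafData} (hD : (D.support : Set G) = {pt})
  {υ₂ : G' ⟶ G} (hυ₂ : IsBlowup υ₂ D) [IsLocallyNoetherian G] [IsLocallyNoetherian X] [IsLocallyNoetherian X'']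
  -- the upstairs blow-up: any centre missing every closed subscheme not through `jG pt`
  {τ : X'' ⟶ X} {C : X.IdealSheafData} (hτ : IsBlowup τ C)
  (hdisj : ∀ I : X.IdealSheafData, jG pt ∉ (I.support : Set X) → Disjoint (I.support : Set X) (C.support : Set X))
  -- the model square and the new stage
  {j₂ : G' ⟶ X''} {t₂ : G' ⟶ Spec (.of k)} (hcomm : j₂ ≫ τ = υ₂ ≫ jG)
  {S'' : Set X''} (hCh'' : Ch X'' (τ ≫ σ) S'') [IsIntegral X''] (hX''reg : Scheme.IsRegular X'') (hdom'' : IsDominant ((τ ≫ σ) ≫ q))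
  (hsq₂ : IsPullback j₂ t₂ ((τ ≫ σ) ≫ q) (Spec.map (CommRingCat.ofHom θ)))
  (hsets : j₂ '' closure (υ₂ ⁻¹' (T \ {pt})) = S'') [IsIntegral G'] (hT'irr : IsIrreducible (closure (υ₂ ⁻¹' (T \ {pt}))))

include hRuledIso hυ' hZ₉inf hTirr hEcl hTE hEsB hExc hExcF hyc hTy hD hυ₂ hτ hdisj hcomm hCh'' hX''reg hdom'' hsq₂ hsets hT'irr

/-- **A point step on `Tower.InvB` at an explicit stage step** (the core of both (pt-reg) and (pt-ram); menus of `TowerPtRegB`/`TowerPtRamB` for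
`K'`, `E'` and the retained list `Es'`). [cite: Liu2002, §8.1 and Thm. 8.1.19] [cite: GortzWedhorn2020, Prop. 13.91 (3) and (13.19)]
[OURS · L1 W4.5b · T23-A engine]; NOT a statement of the manuscript. -/
theorem Tower.invB_pointStep (K' E' : Set G') (Es' : List (Set G'))
    (hK' : K' = ∅ ∨ (pt ∉ closure K ∧ K' = closure (υ₂ ⁻¹' (K \ {pt}))))
    (hE' : E' = υ₂ ⁻¹' {pt} ∨ ((Tower.NoRound υ' G γ E ∨ pt ∉ E) ∧ E' = closure (υ₂ ⁻¹' (E \ {pt}))))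
    (hEs' : ∀ F' ∈ Es', ∃ F ∈ E :: Es, PtTransportOK υ' γ υ₂ pt F F') :
    Tower.InvB O k θ P q Y Ch Ruled F₉ Z₉ hZ₉ F₁₀ υ' G' (υ₂ ≫ γ) (closure (υ₂ ⁻¹' (T \ {pt}))) E' Es' K' := by
  -- every member of `E :: Es`: closed, `T ⊄ F`, shadow-forgotten datum
  have hmem : ∀ F ∈ E :: Es, ∃ hF : IsClosed F, ¬ T ⊆ F ∧ Tower.Exc₃ O P q Y Ruled Z₉ hZ₉ υ' G γ F hF ∅ X σ jG := by
    intro F hF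
    rcases List.mem_cons.mp hF with rfl | hF
    · exact ⟨hEcl, hTE, Tower.exc₃_forgetShadow O P q Y Ruled (hExc hEcl)⟩
    · exact ⟨(hEsB F hF).1, (hEsB F hF).2, hExcF F hF (hEsB F hF).1⟩
  -- the pointwise ruled transports the bricks ask for
  have hRuledPt : ∀ (G₀ G₀' : Scheme.{0}) (γ₀ : G₀ ⟶ F₁₀) (E₀ : Set G₀) (X₀ X₀'' : Scheme.{0}) (σ₀ : X₀ ⟶ P) (j₀ : G₀ ⟶ X₀)
      (j₀' : G₀' ⟶ X₀'') (t₀' : G₀' ⟶ Spec (.of k)) (𝓔₀ : X₀.IdealSheafData) (τ₀ : X₀'' ⟶ X₀) (υ₀ : G₀' ⟶ G₀) (y₀ : G₀),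
      j₀' ≫ τ₀ = υ₀ ≫ j₀ → IsPullback j₀' t₀' ((τ₀ ≫ σ₀) ≫ q) (Spec.map (CommRingCat.ofHom θ)) → y₀ ∉ E₀ →
      (∃ e : (𝓔₀.comap τ₀).subscheme ≅ 𝓔₀.subscheme, e.hom ≫ 𝓔₀.subschemeι = (𝓔₀.comap τ₀).subschemeι ≫ τ₀) →
      Ruled F₉ Z₉ hZ₉ F₁₀ υ' G₀ γ₀ E₀ X₀ σ₀ j₀ 𝓔₀ →
      Ruled F₉ Z₉ hZ₉ F₁₀ υ' G₀' (υ₀ ≫ γ₀) (closure (υ₀ ⁻¹' (E₀ \ {y₀}))) X₀'' (τ₀ ≫ σ₀) j₀' (𝓔₀.comap τ₀) :=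
    fun G₀ G₀' γ₀ E₀ X₀ X₀'' σ₀ j₀ j₀' _ 𝓔₀ τ₀ υ₀ y₀ _ _ _ he hR => hRuledIso G₀ G₀' γ₀ _ E₀ _ X₀ X₀'' σ₀ j₀ j₀' 𝓔₀ τ₀ he hR
  have hRuledAway : ∀ (F : Set G) (𝓕 : X.IdealSheafData),
      (∃ e : (𝓕.comap τ).subscheme ≅ 𝓕.subscheme, e.hom ≫ 𝓕.subschemeι = (𝓕.comap τ).subschemeι ≫ τ) →
      Ruled F₉ Z₉ hZ₉ F₁₀ υ' G γ F X σ jG 𝓕 →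
      Ruled F₉ Z₉ hZ₉ F₁₀ υ' G' (υ₂ ≫ γ) (closure (υ₂ ⁻¹' (F \ {pt}))) X'' (τ ≫ σ) j₂ (𝓕.comap τ) :=
    fun F 𝓕 he hR => hRuledIso G G' γ _ F _ X X'' σ jG j₂ 𝓕 τ he hR
  -- the retained list: bookkeeping and the B-AWAY transport, member by member
  have hEs'B : ∀ F' ∈ Es', IsClosed F' ∧ ¬ closure (υ₂ ⁻¹' (T \ {pt})) ⊆ F' := by
    intro F' hF'
    obtain ⟨F, hFmem, hcond, rfl⟩ := hEs' F' hF'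
    obtain ⟨hF, hTF, -⟩ := hmem F hFmem
    exact ⟨isClosed_closure, not_closure_preimage_diff_subset hυ₂ hTirr hF hyc hTF hTy hD.le⟩
  have hEs'Exc : ∀ F' ∈ Es', ∀ hF' : IsClosed F',
      Tower.Exc₃ O P q Y Ruled Z₉ hZ₉ υ' G' (υ₂ ≫ γ) F' hF' ∅ X'' (τ ≫ σ) j₂ := by
    intro F' hF'
    obtain ⟨F, hFmem, hcond, rfl⟩ := hEs' F' hF'
    obtain ⟨hF, -, hExcF0⟩ := hmem F hFmem
    refine Tower.exc₃_transport_away O P q Y Ruled hτ hυ₂ hD hcomm hRuledAway hF hExcF0 ?_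
    rcases hcond with hno | hptF
    · exact Or.inl hno
    · refine Or.inr ⟨Set.disjoint_singleton_left.mpr hptF, fun 𝓕 h𝓕 => hdisj 𝓕 ?_⟩
      intro hmemsupp
      have h1 : pt ∈ ((𝓕.comap jG).support : Set G) := by rw [support_comap]; exact hmemsupp
      rw [h𝓕, Scheme.IdealSheafData.coe_support_vanishingIdeal] at h1
      exact hptF h1
  -- the running surface
  rcases hE' with rfl | ⟨hside, rfl⟩
  · -- NEW PLANE `E' = υ₂⁻¹{pt}`: hosts no round; any `K'`
    have hTE' : ¬ closure (υ₂ ⁻¹' (T \ {pt})) ⊆ υ₂ ⁻¹' {pt} := by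
      obtain ⟨t, htT, htne⟩ := Set.not_subset.mp hTy
      have htJ : t ∉ (D.support : Set G) := by rw [hD]; exact htne
      obtain ⟨t₂, ht₂⟩ := exists_preimage_of_not_mem_support υ₂ D hυ₂ htJ
      intro hsub
      have h1 : t₂ ∈ closure (υ₂ ⁻¹' (T \ {pt})) := subset_closure (by rw [Set.mem_preimage, ht₂]; exact ⟨htT, htne⟩)
      have h2 := hsub h1
      rw [Set.mem_preimage, ht₂] at h2
      exact htne h2
    exact ⟨hυ', hZ₉inf, inferInstance, isClosed_closure, hT'irr, hyc.preimage υ₂.continuous, hTE', hEs'B, X'', τ ≫ σ, _, j₂, t₂,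
      hCh'', inferInstance, inferInstance, hX''reg, hdom'', hsq₂, hsets,
      fun _ => Or.inl (Tower.noRound_pointCentre_new (υ' := υ') (γ := γ) (pt := pt) (υ₂ := υ₂)), hEs'Exc⟩
  · -- TRANSPORTED SURFACE `E' = closure υ₂⁻¹(E ∖ {pt})`
    have hTE' : ¬ closure (υ₂ ⁻¹' (T \ {pt})) ⊆ closure (υ₂ ⁻¹' (E \ {pt})) :=
      not_closure_preimage_diff_subset hυ₂ hTirr hEcl hyc hTE hTy hD.le
    refine ⟨hυ', hZ₉inf, inferInstance, isClosed_closure, hT'irr, isClosed_closure, hTE', hEs'B, X'', τ ≫ σ, _, j₂, t₂, hCh'',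
      inferInstance, inferInstance, hX''reg, hdom'', hsq₂, hsets, ?_, hEs'Exc⟩
    rcases hK' with rfl | ⟨hyK, rfl⟩
    · -- shadow forgotten: forget it in the old datum, then transport with `K := ∅`
      have hExc0 : ∀ hE : IsClosed E, Tower.Exc₃ O P q Y Ruled Z₉ hZ₉ υ' G γ E hE (∅ : Set G) X σ jG :=
        fun hE => Tower.exc₃_forgetShadow O P q Y Ruled (hExc hE)
      have h := Tower.exc₃_pointCentre_transport O k θ P q Y Ruled hEcl hExc0 hD hυ₂ hτ hdisj hcomm hsq₂ hRuledPt hside (Or.inl rfl)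
      simpa only [Set.empty_sdiff, Set.preimage_empty, closure_empty] using h
    · exact Tower.exc₃_pointCentre_transport O k θ P q Y Ruled hEcl hExc hD hυ₂ hτ hdisj hcomm hsq₂ hRuledPt hside (Or.inr hyK)

end PointStepCore

/-! ## The two clauses of the B-driver -/

section Clauses

variable (O : Type) [CommRing O] [IsDomain O] [IsDiscreteValuationRing O] [IsAdicComplete (maximalIdeal O) O]
  [IsAlgClosed (ResidueField O)] (k : Type) [Field k] (θ : O →+* k) (hθ : Function.Surjective θ)
  (P : Scheme.{0}) (q : P ⟶ Spec (.of O)) (Y : Set P) (hYsp : Y ⊆ q ⁻¹' {closedPoint O}) (hYirr : IsIrreducible Y)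
  (hYcl : IsClosed Y) [IsProper q] [IsIntegral P] (hPnoeth : IsLocallyNoetherian P) (hPreg : Scheme.IsRegular P)
  [SmoothOfRelativeDimension 3 q]
  (Ch : ∀ X' : Scheme.{0}, (X' ⟶ P) → Set X' → Prop)
  (hChain : ∀ (X' : Scheme.{0}) (σ : X' ⟶ P) (S : Set X'), Ch X' σ S → Chain P Y X' σ S)
  (hStep : ∀ (X' X'' : Scheme.{0}) (σ' : X' ⟶ P) (S' : Set X') (C : X'.IdealSheafData) (τ : X'' ⟶ X'),
    Ch X' σ' S' → IsBlowup τ C → Scheme.IsRegular C.subscheme → Flat (C.subschemeι ≫ σ' ≫ q) →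
    σ' '' (C.support : Set X') ⊆ {x : P | ¬ IsGenericPoint x Y} →
    (C.support : Set X') ∩ (σ' ≫ q) ⁻¹' {closedPoint O} ⊆ S' →
    Ch X'' (τ ≫ σ') (closure (τ ⁻¹' (S' \ (C.support : Set X')))))
  (Ruled : Tower.RuledDatum P) (F₉ : Scheme.{0}) (Z₉ : Set F₉) (hZ₉ : IsClosed Z₉) (F₁₀ : Scheme.{0}) (υ' : F₁₀ ⟶ F₉)
  (hRuledIso : ∀ (G₀ G₀' : Scheme.{0}) (γ₀ : G₀ ⟶ F₁₀) (γ₀' : G₀' ⟶ F₁₀) (E₀ : Set G₀) (E₀' : Set G₀') (X₀ X₀'' : Scheme.{0})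
      (σ₀ : X₀ ⟶ P) (j₀ : G₀ ⟶ X₀) (j₀' : G₀' ⟶ X₀'') (𝓔₀ : X₀.IdealSheafData) (τ₀ : X₀'' ⟶ X₀),
    (∃ e : (𝓔₀.comap τ₀).subscheme ≅ 𝓔₀.subscheme, e.hom ≫ 𝓔₀.subschemeι = (𝓔₀.comap τ₀).subschemeι ≫ τ₀) →
    Ruled F₉ Z₉ hZ₉ F₁₀ υ' G₀ γ₀ E₀ X₀ σ₀ j₀ 𝓔₀ → Ruled F₉ Z₉ hZ₉ F₁₀ υ' G₀' γ₀' E₀' X₀'' (τ₀ ≫ σ₀) j₀' (𝓔₀.comap τ₀))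

include hθ hYsp hYirr hYcl hPnoeth hPreg hChain hStep hRuledIso

omit [IsIntegral P] [SmoothOfRelativeDimension 3 q] in
/-- **THE (pt-reg) CLAUSE OF THE B-DRIVER AT `INV₁ := Tower.InvB`** (iso-invariant `Ruled`): `TowerPtRegB F₉ F₁₀ υ' (Tower.InvB … Ruled F₉ Z₉ hZ₉ F₁₀ υ')`.
Stage = a section through `jG y` (`modelPointStep`) and the blow-up of its kernel (`modelPointStep_of_section`), verbatim from `Tower.towerPtReg₂_inv₃`;
then `Tower.invB_pointStep`. [cite: Liu2002, §8.1 and Thm. 8.1.19] [cite: GortzWedhorn2020, Prop. 13.91 (3) and (13.19)] [OURS · L1 W4.5b · T23-A engine]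
toward `stub_elnat_defTowerBPointResolutionThree` (stmt-ResolutionOfSingularities-20148 / -20038); NOT a statement of the manuscript. -/
theorem Tower.towerPtRegB_invB : TowerPtRegB F₉ F₁₀ υ' (Tower.InvB O k θ P q Y Ch Ruled F₉ Z₉ hZ₉ F₁₀ υ') := by
  intro G G' γ T E Es K y υ₂ hyc K' E' Es' hinv hTreg hGreg hυ₂ hK' hE' hEs'
  classical
  obtain ⟨hυ', hZ₉inf, hGint, hTcl, hTirr, hEcl, hTE, hEsB, X, σ, S, jG, tG, hCh, hXint, hXnoeth, hXreg, hdom, hsq, hTS, hExc, hExcF⟩ :=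
    hinv
  haveI := hGint
  haveI := hXint
  haveI := hXnoeth
  have hyT : curvePt G T y ∈ T := subschemeι_mem_of_isClosed hTcl y
  have hTy : ¬ T ⊆ {curvePt G T y} := not_subset_singleton_of_not_isRegularLocalRing_stalk y hTreg hyc
  obtain ⟨-, -, hσ⟩ := chain_isRegular P Y X σ S (hChain _ _ _ hCh) hPnoeth hPreg
  haveI := hσ
  haveI hproper : IsProper (σ ≫ q) := inferInstance
  haveI : IsClosedImmersion (Spec.map (CommRingCat.ofHom θ)) := IsClosedImmersion.spec_of_surjective _ hθ
  haveI hjci : IsClosedImmersion jG := MorphismProperty.IsStableUnderBaseChange.of_isPullback hsq.flip inferInstance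
  have hjyc : IsClosed ({jG (curvePt G T y)} : Set X) := by
    simpa only [Set.image_singleton] using hjci.isClosedEmbedding.isClosedMap _ hyc
  have hyoff : ¬ IsGenericPoint (σ (jG (curvePt G T y))) Y :=
    not_isGenericPoint_of_image_eq (hChain _ _ _ hCh) jG hjci.isClosedEmbedding.injective hTS hjyc hTy
  have hjsp : (σ ≫ q) (jG (curvePt G T y)) = closedPoint O := by
    have h1 : jG (curvePt G T y) ∈ Set.range jG := ⟨_, rfl⟩
    rw [range_eq_preimage_of_isPullback hsq, range_specMap_of_surjective_of_field θ hθ] at h1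
    exact h1
  haveI : IsLocallyNoetherian G := LocallyOfFiniteType.isLocallyNoetherian jG
  -- the section through `jG y` and the blow-up of its kernel, then the model step with this section
  obtain ⟨-, s, X'', τ, -, -, -, hs, hss₀, -, hτ, -, -, hnoeth'', -⟩ :=
    modelPointStep O k θ hθ P q Y hYsp Ch hStep X σ S hCh hXreg hproper hdom G jG tG hsq T hTS (curvePt G T y) hyc hGreg hyT hTy
      hyoff G' υ₂ hυ₂
  haveI := hnoeth''
  obtain ⟨hCh'', hreg'', -, hint'', hdom'', hG'int, hT'irr, -, -, -, -, j₂, t₂, hsq₂, hcomm, -, hsets⟩ :=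
    modelPointStep_of_section O k θ hθ P q Y hYsp hYirr hYcl Ch hChain hStep X σ S hCh hXreg hdom G jG tG hsq T hTS (curvePt G T y)
      hyc hyT hTy hyoff s hs hss₀ X'' τ hτ G' υ₂ hυ₂
  haveI := hint''
  haveI := hG'int
  -- the centre meets the special fibre in `jG y` only
  obtain ⟨_, -, -, hCsupp⟩ := section_isClosedImmersion_and_isRegular_ker O X (σ ≫ q) s hs
  have hCb : (s.ker.support : Set X) ∩ (σ ≫ q) ⁻¹' {closedPoint O} = {jG (curvePt G T y)} := by
    ext z
    constructor
    · rintro ⟨hz, hzsp⟩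
      rw [hCsupp] at hz
      obtain ⟨p, rfl⟩ := hz
      have hp : p = closedPoint O := by
        have h1 : (s ≫ σ ≫ q) p = p := by rw [hs]; rfl
        rw [Scheme.Hom.comp_apply] at h1
        rw [← h1]; exact hzsp
      rw [Set.mem_singleton_iff, hp, hss₀]
    · rintro rfl
      refine ⟨?_, hjsp⟩
      rw [hCsupp, ← hss₀]; exact ⟨_, rfl⟩
  have hdisj : ∀ I : X.IdealSheafData, jG (curvePt G T y) ∉ (I.support : Set X) →
      Disjoint (I.support : Set X) (s.ker.support : Set X) := fun I hI =>
    disjoint_support_of_inter_fibre_eq_singleton (σ ≫ q) s.ker I hCb hI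
  subst hTS
  have hD : ((vanishingIdeal (⟨{curvePt G T y}, hyc⟩ : Closeds G) : G.IdealSheafData).support : Set G) = {curvePt G T y} :=
    Scheme.IdealSheafData.coe_support_vanishingIdeal _
  exact Tower.invB_pointStep O k θ P q Y Ch Ruled hRuledIso hυ' hZ₉inf hTirr hEcl hTE hEsB hExc hExcF hyc hTy hD hυ₂ hτ hdisj hcomm
    hCh'' hreg'' hdom'' hsq₂ hsets hT'irr K' E' Es' hK' hE' hEs'

/-- **THE (pt-ram) CLAUSE OF THE B-DRIVER AT `INV₁ := Tower.InvB`** (iso-invariant `Ruled`): `TowerPtRamB F₉ F₁₀ υ' (Tower.InvB … Ruled F₉ Z₉ hZ₉ F₁₀ υ')`.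
Stage = `fatPointStep_model` (the curvilinear fat point lifts to a regular `O`-flat multisection `Spec O′`; verbatim from `Tower.exists_ptRam_stage₃`);
then `Tower.invB_pointStep`. [cite: Liu2002, §8.1 and Thm. 8.1.19] [cite: GortzWedhorn2020, Prop. 13.91 (3) and (13.19)] [OURS · L1 W4.5b · T23-A engine]
toward `stub_elnat_defTowerBPointResolutionThree`; NOT a statement of the manuscript. -/
theorem Tower.towerPtRamB_invB : TowerPtRamB F₉ F₁₀ υ' (Tower.InvB O k θ P q Y Ch Ruled F₉ Z₉ hZ₉ F₁₀ υ') := by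
  intro G G' γ T E Es K y J υ₂ K' E' Es' hinv hTreg _hGreg hJsupp hJgen hυ₂ hK' hE' hEs'
  classical
  obtain ⟨hυ', hZ₉inf, hGint, hTcl, hTirr, hEcl, hTE, hEsB, X, σ, S, jG, tG, hCh, hXint, hXnoeth, hXreg, hdom, hsq, hTS, hExc, hExcF⟩ :=
    hinv
  haveI := hGint
  haveI := hXint
  haveI := hXnoeth
  have hyT : curvePt G T y ∈ T := subschemeι_mem_of_isClosed hTcl y
  have hyc : IsClosed ({curvePt G T y} : Set G) := hJsupp ▸ J.support.isClosed
  have hTy : ¬ T ⊆ {curvePt G T y} := not_subset_singleton_of_not_isRegularLocalRing_stalk y hTreg hyc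
  haveI : IsClosedImmersion (Spec.map (CommRingCat.ofHom θ)) := IsClosedImmersion.spec_of_surjective _ hθ
  haveI hjci : IsClosedImmersion jG := MorphismProperty.IsStableUnderBaseChange.of_isPullback hsq.flip inferInstance
  have hjyc : IsClosed ({jG (curvePt G T y)} : Set X) := by
    simpa only [Set.image_singleton] using hjci.isClosedEmbedding.isClosedMap _ hyc
  have hyoff : ¬ IsGenericPoint (σ (jG (curvePt G T y))) Y :=
    not_isGenericPoint_of_image_eq (hChain _ _ _ hCh) jG hjci.isClosedEmbedding.injective hTS hjyc hTy
  obtain ⟨ℓ, hℓ, hJℓ, hli⟩ := hJgen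
  obtain ⟨C, X'', τ, j₂, t₂, hτ, -, -, -, -, hdisj, hCh'', hreg'', hnoeth'', hint'', hdom'', -, -, hGnoeth, hG'int, -, hT'irr,
      hsq₂, hcomm, hsets⟩ :=
    fatPointStep_model O k θ hθ P q Y hYsp hYirr hYcl hPnoeth hPreg 3 Ch hChain hStep X σ S hCh hdom G jG tG hsq T hTS
      (curvePt G T y) hyT hTy hyoff J hJsupp ℓ hℓ hJℓ hli G' υ₂ hυ₂
  haveI := hGnoeth
  haveI := hnoeth''
  haveI := hint''
  haveI := hG'int
  subst hTS
  exact Tower.invB_pointStep O k θ P q Y Ch Ruled hRuledIso hυ' hZ₉inf hTirr hEcl hTE hEsB hExc hExcF hyc hTy hJsupp hυ₂ hτ hdisj hcomm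
    hCh'' hreg'' hdom'' hsq₂ hsets hT'irr K' E' Es' hK' hE' hEs'

end Clauses

end Summit.ResolutionOfSingularities.ResolutionOfSingularities.Cruxes.EquisingularLiftNat.Sections

end
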